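import Literature.NumberTheory.LFunctions.WeilMarkovQuadratic
import Literature.NumberTheory.LFunctions.WeilWindowSuzukiProofs
import Literature.NumberTheory.LFunctions.WeilWindowSuzukiAsymptoticProofs
import Summits.RiemannHypothesis.RiemannHypothesis.Theorems.WeilWindowFlowWindowLipschitzStubSupBoundAux
import Mathlib.MeasureTheory.Integral.IntervalIntegral.Basic

/-!
# Stub `stub_barrierEnergy` — the two-scale barrier lies in the form domain
(line `borderline-barrier`, crux `WeilWindowFlow.WindowLipschitz`)

For the explicit barrier `B(x) = (log(1/min(a − |x|, d₀)))^{-1/2}` on `|x| < a` (`0` outside),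
`0 < d₀`, `2d₀ ≤ 1`, `d₀ < a`: `B` is measurable, `0 ≤ B ≤ β₀ = (log 1/d₀)^{-1/2}`, `B` vanishes
off the open window, `B ∈ L²`, and its archimedean energy `∫₀^∞ ρ(t) D_t(B) dt` is finite
(`ρ = weilArchDensity`, `D_t(B) = weilIncrement (B : ℂ) t = ∫ |B(x+t) − B(x)|² dx`).

The finite-energy proof is the `BV`-type bound `D_t(B) ≤ 2 β₀² t` (`t ≥ 0`): with the clamped
profile `W̃(s) = (log(1/min(max(s,0), d₀)))^{-1/2}` (monotone on `ℝ`, `= 0` on `(-∞, 0]`,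
`= β₀` on `[d₀, ∞)`) one has `B(x) = W̃(a − |x|) = min(W̃(a + x), W̃(a − x))`, a minimum of a
non-decreasing and a non-increasing function with values in `[0, β₀]`, so
`|B(x+t) − B(x)|² ≤ β₀ ((W̃(a+x+t) − W̃(a+x)) + (W̃(a−x) − W̃(a−x−t)))`, and for a monotone
step-like `f` (`0` far left, `M` far right) `∫ (f(x+t) − f(x)) dx = M t` (telescoping of interval
integrals).  Against `ρ(t) ≤ e^{t/2}/(2t)` on `(0, 1]` and `ρ ∈ L¹(1, ∞)` with
`D_t(B) ≤ 4‖B‖₂²` this gives the integrability of `t ↦ ρ(t) D_t(B)` on `(0, ∞)`.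
-/

set_option linter.dupNamespace false

noncomputable section

open MeasureTheory Set Filter
open scoped Topology ENNReal NNReal

namespace Summit.RiemannHypothesis.RiemannHypothesis.Theorems.WeilWindowFlowWindowLipschitz

open Literature.NumberTheory.LFunctions

/-! ## Two general bounds on increments -/

/-- `D_t(g) ≤ 4‖g‖₂²` for `g ∈ L²` (`|g(x+t) − g(x)|² ≤ 2|g(x+t)|² + 2|g(x)|²` and translation
invariance). -/
theorem stub_barrierEnergy_weilIncrement_le_four {g : ℝ → ℂ} (hg : MemLp g 2) (t : ℝ) :
    weilIncrement g t ≤ 4 * ∫ x, ‖g x‖ ^ 2 := by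
  have hi2 : Integrable fun x ↦ ‖g x‖ ^ 2 := (memLp_two_iff_integrable_sq_norm hg.1).1 hg
  have hpt : ∀ x, ‖g (x + t) - g x‖ ^ 2 ≤ 2 * ‖g (x + t)‖ ^ 2 + 2 * ‖g x‖ ^ 2 := fun x ↦ by
    nlinarith [norm_sub_le (g (x + t)) (g x), norm_nonneg (g (x + t) - g x),
      norm_nonneg (g (x + t)), norm_nonneg (g x), sq_nonneg (‖g (x + t)‖ - ‖g x‖)]
  unfold weilIncrement
  calc ∫ x, ‖g (x + t) - g x‖ ^ 2 ≤ ∫ x, (2 * ‖g (x + t)‖ ^ 2 + 2 * ‖g x‖ ^ 2) :=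
        integral_mono_of_nonneg (ae_of_all _ fun x ↦ by positivity)
          (((hi2.comp_add_right t).const_mul 2).add (hi2.const_mul 2)) (ae_of_all _ hpt)
    _ = 4 * ∫ x, ‖g x‖ ^ 2 := by
        rw [integral_add ((hi2.comp_add_right t).const_mul 2) (hi2.const_mul 2),
          integral_const_mul, integral_const_mul,
          integral_add_right_eq_self (fun x ↦ ‖g x‖ ^ 2) t]
        ring

/-- **Telescoping for a monotone step-like function.** If `f` is monotone, `f = 0` on `(-∞, c]`
and `f = M` on `[c', ∞)` (`c ≤ c'`), then for `t ≥ 0` the increment `x ↦ f(x + t) − f(x)` is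
integrable and `∫ (f(x + t) − f(x)) dx = M t`. -/
theorem stub_barrierEnergy_mono_integral {f : ℝ → ℝ} {c c' M t : ℝ} (hf : Monotone f)
    (h0 : ∀ x, x ≤ c → f x = 0) (hM : ∀ x, c' ≤ x → f x = M) (hcc' : c ≤ c') (ht : 0 ≤ t) :
    Integrable (fun x ↦ f (x + t) - f x) ∧ ∫ x, (f (x + t) - f x) = M * t := by
  have hft : Monotone fun x ↦ f (x + t) := fun x y hxy ↦ hf (by linarith)
  have hzero : ∀ x, x ∉ Ioc (c - t) c' → f (x + t) - f x = 0 := by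
    intro x hx
    rw [mem_Ioc, not_and_or, not_lt, not_le] at hx
    rcases hx with hx | hx
    · rw [h0 (x + t) (by linarith), h0 x (by linarith), sub_zero]
    · rw [hM (x + t) (by linarith), hM x hx.le, sub_self]
  have hii : IntervalIntegrable (fun x ↦ f (x + t) - f x) volume (c - t) c' :=
    hft.intervalIntegrable.sub hf.intervalIntegrable
  have hint : Integrable (fun x ↦ f (x + t) - f x) :=
    hii.1.integrable_of_forall_notMem_eq_zero hzero
  refine ⟨hint, ?_⟩
  have hle : c - t ≤ c' := by linarith
  have h1 : ∫ x in c'..c' + t, f x = M * t := by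
    rw [intervalIntegral.integral_congr (g := fun _ ↦ M) fun x hx ↦ ?_,
      intervalIntegral.integral_const, smul_eq_mul]
    · ring
    · rw [uIcc_of_le (by linarith)] at hx
      exact hM x hx.1
  have h2 : ∫ x in c - t..c, f x = 0 := by
    rw [intervalIntegral.integral_congr (g := fun _ ↦ (0 : ℝ)) fun x hx ↦ ?_,
      intervalIntegral.integral_zero]
    rw [uIcc_of_le (by linarith)] at hx
    exact h0 x hx.2
  rw [← setIntegral_eq_integral_of_forall_compl_eq_zero hzero,
    ← intervalIntegral.integral_of_le hle,
    intervalIntegral.integral_sub hft.intervalIntegrable hf.intervalIntegrable,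
    intervalIntegral.integral_comp_add_right, sub_add_cancel,
    ← intervalIntegral.integral_add_adjacent_intervals (a := c) (b := c') (c := c' + t)
      hf.intervalIntegrable hf.intervalIntegrable,
    ← intervalIntegral.integral_add_adjacent_intervals (a := c - t) (b := c) (c := c')
      hf.intervalIntegrable hf.intervalIntegrable, h1, h2]
  ring

/-- For `0 ≤ u' ≤ u ≤ M` and `0 ≤ v ≤ v'`:
`(min u v − min u' v')² ≤ M ((u − u') + (v' − v))` (`min` is `1`-Lipschitz in each slot and
both minima lie in `[0, M]`). -/
theorem stub_barrierEnergy_min_sq_le {u u' v v' M : ℝ} (hu0 : 0 ≤ u') (huM : u ≤ M)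
    (hv0 : 0 ≤ v) (huu : u' ≤ u) (hvv : v ≤ v') :
    (min u v - min u' v') ^ 2 ≤ M * ((u - u') + (v' - v)) := by
  have h1 : |min u v - min u' v'| ≤ (u - u') + (v' - v) := by
    refine (abs_min_sub_min_le_max u v u' v').trans ?_
    rw [abs_of_nonneg (sub_nonneg.2 huu), abs_of_nonpos (sub_nonpos.2 hvv), neg_sub]
    exact max_le (le_add_of_nonneg_right (sub_nonneg.2 hvv))
      (le_add_of_nonneg_left (sub_nonneg.2 huu))
  have h2 : |min u v - min u' v'| ≤ M := by
    rw [abs_sub_le_iff]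
    have : min u v ≤ M := (min_le_left _ _).trans huM
    have : 0 ≤ min u' v' := le_min hu0 (hv0.trans hvv)
    have : min u' v' ≤ M := (min_le_left _ _).trans (huu.trans huM)
    have : 0 ≤ min u v := le_min (hu0.trans huu) hv0
    constructor <;> linarith
  calc (min u v - min u' v') ^ 2 = |min u v - min u' v'| * |min u v - min u' v'| := by
        rw [← sq, sq_abs]
    _ ≤ M * ((u - u') + (v' - v)) :=
        mul_le_mul h2 h1 (abs_nonneg _) (hu0.trans (huu.trans huM))

/-! ## The `BV` bound and the finite energy -/

/-- **The `BV` bound.** If `W` is monotone with `W = 0` on `(-∞, 0]`, `W = M` on `[d₀, ∞)`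
(`0 ≤ d₀`) and `B(x) = min(W(a + x), W(a − x))`, then `D_t(B) ≤ 2 M² t` for `t ≥ 0`. -/
theorem stub_barrierEnergy_weilIncrement_le {B W : ℝ → ℝ} {a d₀ M t : ℝ} (hW : Monotone W)
    (hW0 : ∀ s, s ≤ 0 → W s = 0) (hWM : ∀ s, d₀ ≤ s → W s = M) (hd₀ : 0 ≤ d₀)
    (hBW : ∀ x, B x = min (W (a + x)) (W (a - x))) (ht : 0 ≤ t) :
    weilIncrement (fun x ↦ (B x : ℂ)) t ≤ 2 * M ^ 2 * t := by
  have hW0' : ∀ s, 0 ≤ W s := fun s ↦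
    (hW0 (min s 0) (min_le_right _ _)).symm.trans_le (hW (min_le_left _ _))
  have hWM' : ∀ s, W s ≤ M := fun s ↦
    (hW (le_max_left s d₀)).trans_eq (hWM _ (le_max_right _ _))
  obtain ⟨hi1, hI1⟩ := stub_barrierEnergy_mono_integral (f := fun x ↦ W (a + x)) (c := -a)
    (c' := -a + d₀) (M := M) (t := t) (fun x y hxy ↦ hW (by linarith))
    (fun x hx ↦ hW0 _ (by linarith)) (fun x hx ↦ hWM _ (by linarith)) (by linarith) ht
  obtain ⟨hi2, hI2⟩ := stub_barrierEnergy_mono_integral (f := fun x ↦ M - W (a - x))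
    (c := a - d₀) (c' := a) (M := M) (t := t)
    (fun x y hxy ↦ by linarith [hW (show a - y ≤ a - x by linarith)])
    (fun x hx ↦ by rw [hWM _ (by linarith), sub_self])
    (fun x hx ↦ by rw [hW0 _ (by linarith), sub_zero]) (by linarith) ht
  have hpt : ∀ x, ‖((B (x + t) : ℝ) : ℂ) - (B x : ℂ)‖ ^ 2 ≤
      M * ((W (a + (x + t)) - W (a + x)) + ((M - W (a - (x + t))) - (M - W (a - x)))) := by
    intro x
    rw [← Complex.ofReal_sub, Complex.norm_real, Real.norm_eq_abs, sq_abs, hBW, hBW]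
    have h := stub_barrierEnergy_min_sq_le (u := W (a + (x + t))) (u' := W (a + x))
      (v := W (a - (x + t))) (v' := W (a - x)) (M := M) (hW0' _) (hWM' _) (hW0' _)
      (hW (by linarith)) (hW (by linarith))
    linarith
  unfold weilIncrement
  calc ∫ x, ‖((B (x + t) : ℝ) : ℂ) - (B x : ℂ)‖ ^ 2
      ≤ ∫ x, M * ((W (a + (x + t)) - W (a + x)) + ((M - W (a - (x + t))) - (M - W (a - x)))) :=
        integral_mono_of_nonneg (ae_of_all _ fun x ↦ by positivity) ((hi1.add hi2).const_mul M)
          (ae_of_all _ hpt)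
    _ = M * (M * t + M * t) := by rw [integral_const_mul, integral_add hi1 hi2, hI1, hI2]
    _ = 2 * M ^ 2 * t := by ring

/-- **Finite archimedean energy from a linear increment bound.** If `B ∈ L²` (real, cast to `ℂ`)
and `D_t(B) ≤ C t` for `t ≥ 0`, then `t ↦ ρ(t) D_t(B)` is integrable on `(0, ∞)`
(`ρ(t) ≤ e^{t/2}/(2t)` on `(0, 1]`; `D_t(B) ≤ 4‖B‖₂²` and `ρ ∈ L¹(1, ∞)`). -/
theorem stub_barrierEnergy_integrableOn_of_le {B : ℝ → ℝ} {C : ℝ}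
    (hB2 : MemLp (fun x ↦ (B x : ℂ)) 2)
    (hD : ∀ t, 0 ≤ t → weilIncrement (fun x ↦ (B x : ℂ)) t ≤ C * t) :
    IntegrableOn (fun t ↦ weilArchDensity t * weilIncrement (fun x ↦ (B x : ℂ)) t) (Ioi 0) := by
  have hmeas : AEStronglyMeasurable
      (fun t ↦ weilArchDensity t * weilIncrement (fun x ↦ (B x : ℂ)) t) volume :=
    measurable_weilArchDensity.aestronglyMeasurable.mul (stub_supBound_aesm_weilIncrement hB2.1)
  have hnn : ∀ t, 0 < t → 0 ≤ weilArchDensity t * weilIncrement (fun x ↦ (B x : ℂ)) t :=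
    fun t ht ↦ mul_nonneg (weilArchDensity_pos ht).le (weilIncrement_nonneg _ _)
  have hC : 0 ≤ C := by
    have h := (weilIncrement_nonneg (fun x ↦ (B x : ℂ)) 1).trans (hD 1 zero_le_one)
    linarith
  rw [← Ioc_union_Ioi_eq_Ioi zero_le_one]
  refine IntegrableOn.union ?_ ?_
  · have hK : IntegrableOn (fun _ ↦ (C * Real.exp (1 / 2) / 2 : ℝ)) (Ioc (0 : ℝ) 1) :=
      integrableOn_const (measure_Ioc_lt_top).ne
    refine Integrable.mono' hK hmeas.restrict ?_
    refine (ae_restrict_iff' measurableSet_Ioc).2 (ae_of_all _ fun t ht ↦ ?_)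
    have ht0 : 0 < t := ht.1
    rw [Real.norm_of_nonneg (hnn t ht0)]
    calc weilArchDensity t * weilIncrement (fun x ↦ (B x : ℂ)) t
        ≤ Real.exp (t / 2) / (2 * t) * (C * t) :=
          mul_le_mul (weilArchDensity_le_exp_half_div ht0) (hD t ht0.le)
            (weilIncrement_nonneg _ _) (by positivity)
      _ = C * Real.exp (t / 2) / 2 := by
          field_simp
      _ ≤ C * Real.exp (1 / 2) / 2 := by
          gcongr
          exact ht.2
  · refine Integrable.mono'
      ((integrableOn_weilArchDensity_Ioi one_pos).mul_const (4 * ∫ x, ‖(B x : ℂ)‖ ^ 2))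
      hmeas.restrict ?_
    refine (ae_restrict_iff' measurableSet_Ioi).2 (ae_of_all _ fun t (ht : 1 < t) ↦ ?_)
    rw [Real.norm_of_nonneg (hnn t (one_pos.trans ht))]
    exact mul_le_mul_of_nonneg_left (stub_barrierEnergy_weilIncrement_le_four hB2 t)
      (weilArchDensity_pos (one_pos.trans ht)).le

/-! ## The clamped profile `W̃(s) = (log(1/min(max(s, 0), d₀)))^{-1/2}` -/

/-- Monotonicity of the profile `s ↦ (log 1/s)^{-1/2}` on `(0, d₀]`, `2d₀ ≤ 1`. -/
theorem stub_barrierEnergy_profile_mono {d₀ s s' : ℝ} (h2 : 2 * d₀ ≤ 1) (hs : 0 < s)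
    (hss' : s ≤ s') (hs' : s' ≤ d₀) :
    1 / Real.sqrt (Real.log (1 / s)) ≤ 1 / Real.sqrt (Real.log (1 / s')) := by
  have hs'0 : 0 < s' := hs.trans_le hss'
  have h1 : 1 < 1 / s' := by
    rw [lt_div_iff₀ hs'0]
    linarith
  have hlog : 0 < Real.log (1 / s') := Real.log_pos h1
  have hle : Real.log (1 / s') ≤ Real.log (1 / s) :=
    Real.log_le_log (by positivity) (one_div_le_one_div_of_le hs hss')
  exact one_div_le_one_div_of_le (Real.sqrt_pos.2 hlog) (Real.sqrt_le_sqrt hle)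

/-- The clamped profile is monotone on `ℝ`. -/
theorem stub_barrierEnergy_clamp_mono {d₀ : ℝ} (hd₀ : 0 < d₀) (h2 : 2 * d₀ ≤ 1) :
    Monotone fun s : ℝ ↦ 1 / Real.sqrt (Real.log (1 / min (max s 0) d₀)) := by
  intro s s' hss'
  have hmm' : min (max s 0) d₀ ≤ min (max s' 0) d₀ := min_le_min (max_le_max hss' le_rfl) le_rfl
  have hm0 : 0 ≤ min (max s 0) d₀ := le_min (le_max_right _ _) hd₀.le
  rcases hm0.eq_or_lt with h | h
  · simp only [← h, div_zero, Real.log_zero, Real.sqrt_zero]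
    positivity
  · exact stub_barrierEnergy_profile_mono h2 h hmm' (min_le_right _ _)

/-- The clamped profile vanishes on `(-∞, 0]`. -/
theorem stub_barrierEnergy_clamp_of_nonpos {d₀ s : ℝ} (hd₀ : 0 < d₀) (hs : s ≤ 0) :
    1 / Real.sqrt (Real.log (1 / min (max s 0) d₀)) = 0 := by
  rw [max_eq_right hs, min_eq_left hd₀.le]
  simp

/-- The clamped profile equals `β₀ = (log 1/d₀)^{-1/2}` on `[d₀, ∞)`. -/
theorem stub_barrierEnergy_clamp_of_le {d₀ s : ℝ} (hs : d₀ ≤ s) :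
    1 / Real.sqrt (Real.log (1 / min (max s 0) d₀)) = 1 / Real.sqrt (Real.log (1 / d₀)) := by
  rw [min_eq_right (hs.trans (le_max_left s 0))]

/-- The barrier is the clamped profile of the distance to the edge: `B(x) = W̃(a − |x|)`. -/
theorem stub_barrierEnergy_eq_clamp {B : ℝ → ℝ} {a d₀ : ℝ} (hd₀ : 0 < d₀)
    (hB : ∀ x, B x = if |x| < a then 1 / Real.sqrt (Real.log (1 / min (a - |x|) d₀)) else 0)
    (x : ℝ) : B x = 1 / Real.sqrt (Real.log (1 / min (max (a - |x|) 0) d₀)) := by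
  rw [hB x]
  split_ifs with h
  · rw [max_eq_left (sub_pos.2 h).le]
  · rw [max_eq_right (sub_nonpos.2 (not_lt.1 h)), min_eq_left hd₀.le]
    simp

/-! ## The stub -/

/-- **Stub S2a `stub_barrierEnergy` — the barrier lies in the form domain.** For the explicit
barrier `B` (window `a`, freezing depth `d₀`, `2d₀ ≤ 1`, `d₀ < a`): `B` is measurable,
`0 ≤ B ≤ β₀ = (log 1/d₀)^{-1/2}`, `B = 0` off the open window, `B ∈ L²`, and its archimedean
energy is finite: `t ↦ ρ(t) D_t(B)` is integrable on `(0, ∞)` (via the `BV` bound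
`D_t(B) ≤ 2β₀² t`, `stub_barrierEnergy_weilIncrement_le`). -/
theorem stub_barrierEnergy :
    ∀ (a d₀ : ℝ) (B : ℝ → ℝ), 0 < d₀ → 2 * d₀ ≤ 1 → d₀ < a →
      (∀ x, B x = if |x| < a then 1 / Real.sqrt (Real.log (1 / min (a - |x|) d₀)) else 0) →
      Measurable B ∧ (∀ x, 0 ≤ B x ∧ B x ≤ 1 / Real.sqrt (Real.log (1 / d₀))) ∧
        (∀ x, a ≤ |x| → B x = 0) ∧ MemLp (fun x ↦ (B x : ℂ)) 2 ∧
        IntegrableOn (fun t ↦ weilArchDensity t * weilIncrement (fun x ↦ (B x : ℂ)) t) (Ioi 0) := by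
  intro a d₀ B hd₀ h2d₀ _hd₀a hB
  set W : ℝ → ℝ := fun s ↦ 1 / Real.sqrt (Real.log (1 / min (max s 0) d₀)) with hW
  set β₀ : ℝ := 1 / Real.sqrt (Real.log (1 / d₀)) with hβ₀
  have hWmono : Monotone W := stub_barrierEnergy_clamp_mono hd₀ h2d₀
  have hW0 : ∀ s, s ≤ 0 → W s = 0 := fun s hs ↦ stub_barrierEnergy_clamp_of_nonpos hd₀ hs
  have hWM : ∀ s, d₀ ≤ s → W s = β₀ := fun s hs ↦ stub_barrierEnergy_clamp_of_le hs
  have hW0' : ∀ s, 0 ≤ W s := fun s ↦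
    (hW0 (min s 0) (min_le_right _ _)).symm.trans_le (hWmono (min_le_left _ _))
  have hWM' : ∀ s, W s ≤ β₀ := fun s ↦
    (hWmono (le_max_left s d₀)).trans_eq (hWM _ (le_max_right _ _))
  have hBW' : ∀ x, B x = W (a - |x|) := fun x ↦ stub_barrierEnergy_eq_clamp hd₀ hB x
  have hBW : ∀ x, B x = min (W (a + x)) (W (a - x)) := fun x ↦ by
    rw [hBW', abs_eq_max_neg, max_comm, ← min_sub_sub_left, sub_neg_eq_add, hWmono.map_min]
  have hBmeas : Measurable B := by
    rw [show B = fun x ↦ W (a - |x|) from funext hBW']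
    exact hWmono.measurable.comp (measurable_const.sub continuous_abs.measurable)
  have hBbd : ∀ x, 0 ≤ B x ∧ B x ≤ β₀ := fun x ↦ by
    rw [hBW']
    exact ⟨hW0' _, hWM' _⟩
  have hBsupp : ∀ x, a ≤ |x| → B x = 0 := fun x hx ↦ by
    rw [hBW']
    exact hW0 _ (sub_nonpos.2 hx)
  have hBc : AEStronglyMeasurable (fun x ↦ (B x : ℂ)) volume :=
    (Complex.measurable_ofReal.comp hBmeas).aestronglyMeasurable
  have hB2 : MemLp (fun x ↦ (B x : ℂ)) 2 := by
    refine (memLp_two_iff_integrable_sq_norm hBc).2 ?_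
    have hg : Integrable (indicator (Icc (-a) a) fun _ ↦ β₀ ^ 2) :=
      (integrableOn_const (measure_Icc_lt_top).ne).integrable_indicator measurableSet_Icc
    refine hg.mono' ((Complex.measurable_ofReal.comp hBmeas).norm.pow_const 2).aestronglyMeasurable
      (ae_of_all _ fun x ↦ ?_)
    rw [Real.norm_of_nonneg (by positivity), Complex.norm_real, Real.norm_eq_abs, sq_abs]
    by_cases hx : x ∈ Icc (-a) a
    · rw [indicator_of_mem hx]
      exact pow_le_pow_left₀ (hBbd x).1 (hBbd x).2 2
    · rw [indicator_of_notMem hx]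
      have hx' : a ≤ |x| := by
        rw [mem_Icc, ← abs_le, not_le] at hx
        exact hx.le
      rw [hBsupp x hx']
      simp
  refine ⟨hBmeas, hBbd, hBsupp, hB2, ?_⟩
  exact stub_barrierEnergy_integrableOn_of_le hB2 fun t ht ↦
    stub_barrierEnergy_weilIncrement_le hWmono hW0 hWM hd₀.le hBW ht

end Summit.RiemannHypothesis.RiemannHypothesis.Theorems.WeilWindowFlowWindowLipschitz

end
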